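import Summits.ResolutionOfSingularities.ResolutionOfSingularities.Theses.AbhyankarShadows
import Summits.ResolutionOfSingularities.ResolutionOfSingularities.Theses.IndSmooth
import Summits.ResolutionOfSingularities.ResolutionOfSingularities.Theorems.PatchingPerfect.Negative.BirthResidual
import Summits.ResolutionOfSingularities.ResolutionOfSingularities.Theorems.RegularBlowupsDesingularization

/-!
# Crux `PatchingPerfect` (stmt-ResolutionOfSingularities-16089) from its single residual —
# line `birth`, reshape v2 (lead seat 0): the composition, BY NAME, for both route copies

The reshaped skeleton `Cruxes/PatchingPerfect/Lines/birth.lean` (v2) has ONE stub,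
`stub_sandwichedPatchingPerfect : ∀ p prime, ∀ k perfect of char p, RelLU_k → SingAdmQProj_k`
("relative local uniformization over `k` ⇒ every blowing up `V = Bl_I U` of a regular integral
quasi-projective `k`-variety along `I ≠ 0` is desingularised by a blowing up cosupported in
`Sing V`" — Zariski's 1944 patching for the basic sandwiched class over one perfect field; open in
dimension `≥ 4`). This file lands the skeleton's composition as importable theorems, sorry-free and
unconditional (implications), with the stub's predicates written out verbatim (no new `def`):

* `patchingPerfect_of_sandwichedPatchingPerfect` — the residual implies
  `Theses.AbhyankarShadows.PatchingPerfect` (one line over the landed slack theorem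
  `PatchingPerfect.Negative.patchingPerfect_birth_resolves_of_singAdmissibleQProj_of_relLU`,
  p162713: Liu 8.1.24 as the tree theorem `Liu2002Thm8124Projective_holds`, RegLe-ification of
  projective models, two-model patching on the join, the dimension-free Zariski–Piltant engine);
* `indSmooth_patchingPerfect_of_sandwichedPatchingPerfect` — the same for
  `Theses.IndSmooth.PatchingPerfect` (one term);
* `patchingPerfect_of_regularBlowupSingAdmissibleResolutionQProj` — in particular the crux
  follows from the EXISTING all-fields conjecture leaf
  `RegularBlowupSingAdmissibleResolutionQProj` (`Theorems/RegularBlowupsDesingularization.lean`,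
  the line-dead atom of the sibling crux `PatchingRel`, stmt-0642) taken at every prime: the two
  cruxes share ONE open statement, of which this crux needs only the perfect-field slice, and only
  under the extra hypothesis `RelLU_k`.

References: O. Piltant, RACSAM 107 (2013) 91–121, Prop. 5.1 (P = P_reg) and Cor. 5.7
[Piltant2013]; O. Zariski, Ann. of Math. 45 (1944) 472–542, Fundamental Theorem [Zariski1944];
Q. Liu, *Algebraic Geometry and Arithmetic Curves* (2002), Thm. 8.1.24 [Liu2002].
-/

noncomputable section

-- single-problem summit: the doubled namespace component `ResolutionOfSingularities` is forced
set_option linter.dupNamespace false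

open CategoryTheory AlgebraicGeometry TopologicalSpace
open Literature.AlgebraicGeometry.Resolution Literature.AlgebraicGeometry.Motives
open Summit.ResolutionOfSingularities.ResolutionOfSingularities.Theses

namespace Summit.ResolutionOfSingularities.ResolutionOfSingularities.Theorems

/-- **The crux `PatchingPerfect` from its single residual (line `birth`, v2)**: if over every
perfect field `k` of every prime characteristic relative local uniformization over `k` implies
Sing-admissible blow-up desingularization of blowings up of regular quasi-projective
`k`-varieties, then `PatchingPerfect` holds — at `(p, k)` feed the crux's own antecedent to the
hypothesis and apply the landed slack theorem
`PatchingPerfect.Negative.patchingPerfect_birth_resolves_of_singAdmissibleQProj_of_relLU`.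
[cite: Piltant2013, Prop. 5.1 and Cor. 5.7] [cite: Liu2002, Thm. 8.1.24] -/
theorem patchingPerfect_of_sandwichedPatchingPerfect
    (h : ∀ p : ℕ, p.Prime → ∀ (k : Type) [Field k] [CharP k p] [PerfectField k],
      (∀ (K : Type) [Field K] [Algebra k K], (⊤ : IntermediateField k K).FG →
        ∀ O : ValuationSubring K, (∀ c : k, algebraMap k K c ∈ O) → ∀ R : Subalgebra k K, R.FG →
          R.toSubring ≤ O.toSubring → ∃ (A : Subalgebra k K) (h : A.toSubring ≤ O.toSubring),
            R ≤ A ∧ A.FG ∧ IsFractionRing A K ∧ IsRegularLocalRing (Localization.AtPrime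
              (Ideal.comap (Subring.inclusion h) (IsLocalRing.maximalIdeal O)))) →
      ∀ (U V : Scheme.{0}) (f : U ⟶ Spec (.of k)) (η : V ⟶ U) (I : U.IdealSheafData),
        IsSeparated f → LocallyOfFiniteType f → QuasiCompact f → IsIntegral U →
        Scheme.IsRegular U →
        (∃ (P : Scheme.{0}) (πP : P ⟶ Spec (.of k)) (j : U ⟶ P),
          IsProjectiveOver (Over.mk πP) ∧ IsOpenImmersion j ∧ j ≫ πP = f) →
        I ≠ ⊥ → IsBlowup η I →
          ∃ (J : V.IdealSheafData) (V' : Scheme.{0}) (π : V' ⟶ V),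
            J ≠ ⊥ ∧ (∀ x : V, x ∈ J.support → ¬ IsRegularLocalRing (V.presheaf.stalk x)) ∧
              IsBlowup π J ∧ Scheme.IsRegular V') :
    AbhyankarShadows.PatchingPerfect :=
  fun p hp k _ _ _ hLU X f hs hl hq hr =>
    PatchingPerfect.Negative.patchingPerfect_birth_resolves_of_singAdmissibleQProj_of_relLU k
      (h p hp k hLU) hLU X f hs hl hq hr

/-- The same composition for the `IndSmooth` copy of the shared crux (the two route copies are
one term). [cite: Piltant2013, Prop. 5.1 and Cor. 5.7] -/
theorem indSmooth_patchingPerfect_of_sandwichedPatchingPerfect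
    (h : ∀ p : ℕ, p.Prime → ∀ (k : Type) [Field k] [CharP k p] [PerfectField k],
      (∀ (K : Type) [Field K] [Algebra k K], (⊤ : IntermediateField k K).FG →
        ∀ O : ValuationSubring K, (∀ c : k, algebraMap k K c ∈ O) → ∀ R : Subalgebra k K, R.FG →
          R.toSubring ≤ O.toSubring → ∃ (A : Subalgebra k K) (h : A.toSubring ≤ O.toSubring),
            R ≤ A ∧ A.FG ∧ IsFractionRing A K ∧ IsRegularLocalRing (Localization.AtPrime
              (Ideal.comap (Subring.inclusion h) (IsLocalRing.maximalIdeal O)))) →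
      ∀ (U V : Scheme.{0}) (f : U ⟶ Spec (.of k)) (η : V ⟶ U) (I : U.IdealSheafData),
        IsSeparated f → LocallyOfFiniteType f → QuasiCompact f → IsIntegral U →
        Scheme.IsRegular U →
        (∃ (P : Scheme.{0}) (πP : P ⟶ Spec (.of k)) (j : U ⟶ P),
          IsProjectiveOver (Over.mk πP) ∧ IsOpenImmersion j ∧ j ≫ πP = f) →
        I ≠ ⊥ → IsBlowup η I →
          ∃ (J : V.IdealSheafData) (V' : Scheme.{0}) (π : V' ⟶ V),
            J ≠ ⊥ ∧ (∀ x : V, x ∈ J.support → ¬ IsRegularLocalRing (V.presheaf.stalk x)) ∧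
              IsBlowup π J ∧ Scheme.IsRegular V') :
    IndSmooth.PatchingPerfect :=
  patchingPerfect_of_sandwichedPatchingPerfect h

/-- **The crux follows from the existing all-fields conjecture leaf
`RegularBlowupSingAdmissibleResolutionQProj`** (Sing-admissible blow-up desingularization of
blowings up of regular quasi-projective varieties, every field of characteristic `p`) taken at
every prime — slice to perfect `k` and discard the LU hypothesis. So `PatchingPerfect` and the
sibling crux `PatchingRel` (stmt-0642, whose line reduced it to this very leaf) share one open
statement; this crux needs only its perfect-field slice. [cite: Piltant2013, Def. 5.4 and Prop. 5.1] -/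
theorem patchingPerfect_of_regularBlowupSingAdmissibleResolutionQProj
    (h : ∀ p : ℕ, p.Prime → RegularBlowupSingAdmissibleResolutionQProj.{0} p) :
    AbhyankarShadows.PatchingPerfect :=
  patchingPerfect_of_sandwichedPatchingPerfect fun p hp k _ _ _ _ => h p hp k

/-- … and likewise the `IndSmooth` copy. [cite: Piltant2013, Def. 5.4 and Prop. 5.1] -/
theorem indSmooth_patchingPerfect_of_regularBlowupSingAdmissibleResolutionQProj
    (h : ∀ p : ℕ, p.Prime → RegularBlowupSingAdmissibleResolutionQProj.{0} p) :
    IndSmooth.PatchingPerfect :=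
  patchingPerfect_of_regularBlowupSingAdmissibleResolutionQProj h

end Summit.ResolutionOfSingularities.ResolutionOfSingularities.Theorems

end
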